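import Mathlib
import Summits.Ventures.PercRepro2.GenTail
import Summits.Ventures.PercRepro2.StrandSplit

/-!
# The spanning-tree packing number of a random subgraph: the `a = 1` rows and the `τ ≤ 2` case of
row B2-TREE (seat mine-b, cell pub-perc-repro2)

`Spans ends S` says that the edge set `S` carries every vertex to every vertex (a connected spanning
subgraph); `k` pairwise disjoint spanning connected edge sets among the open edges is the same as
`k` pairwise edge-disjoint open spanning trees, so `treeEvent ends k = genIn (Spans ends) univ k` is
the event `τ ≥ k` for the spanning-tree packing number `τ` (Nash-Williams–Tutte) of the open
subgraph.  Row B2-TREE (MINE-B.md §9) conjectures that `k ↦ P(τ ≥ k)` is log-concave for every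
finite graph and product measure.  Here, from the packing-tail engine of `GenTail.lean`:
`prob_genIn_succ_le` (iterated BK for any increasing predicate inside a part), hence
`treeEvent_succ_le` / `treeEvent_le_pow` (the `a = 1` rows of the BAL family for `τ` on every
graph), and `tree_logconcave_of_no_three`: **row B2-TREE holds on every graph without three
edge-disjoint spanning trees** (every graph with fewer than `3(|V| − 1)` edges, all graphs on
≤ 5 vertices).  `treeEvent_one` identifies `τ ≥ 1` with connectivity of the open graph.
-/

open Finset

namespace Summit.Ventures.PercRepro2

open IFR

section IteratedBKPart

variable {E : Type*} [Fintype E] [DecidableEq E]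

/-- **iterated BK inside a part** for any increasing predicate: `P(level ≥ k+1) ≤ P(level ≥ 1)·P(level ≥ k)` -/
theorem prob_genIn_succ_le {p : E → ℝ} (hp : IsProbVec p) {A : Finset E → Prop} (hA : ReimerCube.Incr A)
    (E₁ : Finset E) (k : ℕ) :
    prob p (genIn A E₁ (k + 1)) ≤ prob p (genIn A E₁ 1) * prob p (genIn A E₁ k) := by
  classical
  have hp' : ∀ i, 0 ≤ p i ∧ p i ≤ 1 := fun i => ⟨hp.nonneg i, hp.le_one i⟩
  rw [prob_genIn_eq_sum_wt p hA, prob_genIn_eq_sum_wt p hA, prob_genIn_eq_sum_wt p hA]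
  have h := kDisj_succ_le p hp' _ (incr_inter_of_incr hA E₁) k
  have h1 : (∑ S ∈ Finset.univ.powerset.filter (kDisj (fun T => A (T ∩ E₁)) 1), ReimerCube.wt Finset.univ p S)
      = ∑ S ∈ Finset.univ.powerset.filter (fun T => A (T ∩ E₁)), ReimerCube.wt Finset.univ p S := by
    apply sum_filter_congr_pred
    intro S
    exact kDisj_one_iff (incr_inter_of_incr hA E₁) S
  rw [h1]
  exact h

/-- **`P(level ≥ k) ≤ P(level ≥ 1)^k`** inside a part -/
theorem prob_genIn_le_pow {p : E → ℝ} (hp : IsProbVec p) {A : Finset E → Prop} (hA : ReimerCube.Incr A)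
    (E₁ : Finset E) : ∀ k : ℕ, prob p (genIn A E₁ k) ≤ prob p (genIn A E₁ 1) ^ k
  | 0 => by rw [genIn_zero, prob_univ, pow_zero]
  | k + 1 => by
      calc prob p (genIn A E₁ (k + 1)) ≤ prob p (genIn A E₁ 1) * prob p (genIn A E₁ k) :=
            prob_genIn_succ_le hp hA E₁ k
        _ ≤ prob p (genIn A E₁ 1) * prob p (genIn A E₁ 1) ^ k :=
            mul_le_mul_of_nonneg_left (prob_genIn_le_pow hp hA E₁ k) (prob_nonneg hp _)
        _ = prob p (genIn A E₁ 1) ^ (k + 1) := by ring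

end IteratedBKPart

section Trees

variable {V : Type*} {E : Type*} [Fintype E] [DecidableEq E]

/-- **`S` spans**: it carries every vertex to every vertex (a connected spanning edge set) -/
def Spans (ends : E → Sym2 V) (S : Finset E) : Prop := ∀ u w : V, Carries ends S u w

omit [Fintype E] in
/-- spanning is increasing -/
lemma incr_spans (ends : E → Sym2 V) : ReimerCube.Incr (Spans ends) :=
  fun _ _ h hS u w => Carries.mono h (hS u w)

omit [Fintype E] in
/-- with two distinct vertices the empty edge set does not span -/
lemma not_spans_empty [Nontrivial V] (ends : E → Sym2 V) : ¬ Spans ends (∅ : Finset E) := by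
  obtain ⟨u, w, huw⟩ := exists_pair_ne V
  intro h
  exact not_carries_empty huw (h u w)

/-- **the event `τ ≥ k`**: the open edges contain `k` pairwise disjoint spanning connected edge
sets, i.e. `k` edge-disjoint open spanning trees -/
def treeEvent (ends : E → Sym2 V) (k : ℕ) : Set (Config E) := genIn (Spans ends) Finset.univ k

/-- `τ ≥ 1` is connectivity of the open graph -/
theorem treeEvent_one (ends : E → Sym2 V) :
    treeEvent ends 1 = {ω | ∀ u w : V, Conn ends ω u w} := by
  ext ω
  simp only [treeEvent, genIn, Set.mem_setOf_eq, Finset.inter_univ]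
  rw [kDisj_one_iff (incr_spans ends)]
  unfold Spans Carries
  rw [ofFinset_openSet]

/-- `τ ≥ 0` always -/
theorem treeEvent_zero (ends : E → Sym2 V) : treeEvent ends 0 = Set.univ := genIn_zero _ _

/-- **the `a = 1` rows of the BAL family for the tree packing number** on every finite multigraph:
`P(τ ≥ k+1) ≤ P(τ ≥ 1)·P(τ ≥ k)` -/
theorem treeEvent_succ_le {p : E → ℝ} (hp : IsProbVec p) (ends : E → Sym2 V) (k : ℕ) :
    prob p (treeEvent ends (k + 1)) ≤ prob p (treeEvent ends 1) * prob p (treeEvent ends k) :=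
  prob_genIn_succ_le hp (incr_spans ends) Finset.univ k

/-- **`P(τ ≥ k) ≤ P(connected)^k`** on every finite multigraph -/
theorem treeEvent_le_pow {p : E → ℝ} (hp : IsProbVec p) (ends : E → Sym2 V) (k : ℕ) :
    prob p (treeEvent ends k) ≤ prob p (treeEvent ends 1) ^ k :=
  prob_genIn_le_pow hp (incr_spans ends) Finset.univ k

/-- **row B2-TREE on every graph without three edge-disjoint spanning trees**:
`P(τ ≥ k)·P(τ ≥ k+2) ≤ P(τ ≥ k+1)²` for every product measure -/
theorem tree_logconcave_of_no_three {p : E → ℝ} (hp : IsProbVec p) (ends : E → Sym2 V)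
    (h3 : treeEvent ends 3 = ∅) (k : ℕ) :
    prob p (treeEvent ends k) * prob p (treeEvent ends (k + 2))
      ≤ prob p (treeEvent ends (k + 1)) * prob p (treeEvent ends (k + 1)) :=
  genIn_logconcave_of_no_three hp (incr_spans ends) Finset.univ h3 k

/-- the same as a log-concave tail (`genTail` at the whole edge set) -/
theorem isLCTail_treeTail_of_no_three [Nontrivial V] {p : E → ℝ} (hp : IsProbVec p) (ends : E → Sym2 V)
    (h3 : treeEvent ends 3 = ∅) :
    IsLCTail (genTail p (Spans ends) Finset.univ) ((Finset.univ : Finset E).card + 1) :=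
  isLCTail_genTail_of_no_three hp (incr_spans ends) (not_spans_empty ends) Finset.univ h3

omit [Fintype E] in
/-- a spanning edge set has at least `|V| − 1` edges: each witness of `Spans` has positive
cardinality once `V` is nontrivial (what is used below) -/
lemma spans_nonempty [Nontrivial V] {ends : E → Sym2 V} {S : Finset E} (h : Spans ends S) : S.Nonempty := by
  rw [Finset.nonempty_iff_ne_empty]
  rintro rfl
  exact not_spans_empty ends h

end Trees

end Summit.Ventures.PercRepro2
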